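import Mathlib
import HarnessLib
import Literature.Probability.MarkovChains.LogSobolevPiChain
import Literature.Probability.MarkovChains.LogSobolevProductChains
import Literature.Probability.MarkovChains.MultiproposalPeskunBound
import Literature.Probability.MarkovChains.CycleEigenfunctions

/-!
# The log-Sobolev constant of every two-state chain and of the loop-free walk on the complete graph (Diaconis–Saloff-Coste 1996, App. Cor A.3 and Cor A.5)

HONEST FRAMING: exact (Metropolis-corrected) sampling algorithms for lattice gauge theory; figures
of merit are autocorrelation/cost numbers at stated couplings and volumes; no continuum-physics claim.

Source (READ on the hub's materialised text, Appendix pp. 746–748): P. Diaconis, L. Saloff-Coste,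
*Logarithmic Sobolev inequalities for finite Markov chains*, Ann. Appl. Probab. **6** (1996) 695–750
[DiaconisSaloffcoste1996].  "the result of Theorem 5.2 determines the log-Sobolev constant for all
kernels on a two-point space.  **COROLLARY A.3.** Let `X = {0,1}`. Let `K` be a Markov kernel on `X`
with stationary distribution `π(x)`. Assume that `π(0) ≤ π(1)`. Then the log-Sobolev constant
`α = α(K)` equals `K(0,1)(1 − 2π(0)) / (π(1) log[π(1)/π(0)])`.  If `π(1) ≤ π(0)`, reverse the roles of
`0` and `1`.  PROOF. The Dirichlet form `𝓔_K` equals `K(0,1)π(0)|f(0) − f(1)|²`, whereas the Dirichlet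
form used in Theorem A.2 is `π(0)π(1)|f(0) − f(1)|²`. This proves the corollary.  REMARK. Observe that
`K` has spectral gap `λ = K(0,1) + K(1,0)`. It follows that the ratio `α_K/λ_K = (1 − 2π(0))/
log[π(1)/π(0)] ≤ 1/2` with strict inequality unless `π(0) = 1/2`."  **COROLLARY A.5.** "On a finite
set `X`, consider the Markov kernel `K(x,y) = 1/(|X| − 1)` if `x ≠ y` and `K(x,x) = 0`. This has
stationary measure `π ≡ 1/|X|`. The associated logarithmic Sobolev constant is `α = (|X| − 2)/
((|X| − 1) log(|X| − 1))`.  In particular, the simple random walk on `X = ℤ₃` has log-Sobolev constant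
`α = 1/(2 log 2)`.  This readily follows from Theorem A.1. Observe that simple random walk on `ℤ₃` has
spectral gap `λ = 1 − cos(2π/3) = 3/2`. Thus `λ/2 = 0.75` whereas `α ≈ 0.72 < λ/2` in this case."
Everything below is PROVED (finite sums and one-variable calculus; 0 named facts).

VOCABULARY (the tree's, reused — nothing re-declared): `α = logSobolevConst`, `λ = spectralGapR`,
`𝓔 = dirichletForm`, `Var = lawVariance` (`PeskunOrdering`, `LogSobolevConstant`,
`DistinguishingStatistic`); the two-point law `twoPointPiGen θ = (1 − θ, θ)` and kernel
`twoPointKernelGen θ` (`K_θ(x,y) = π_θ(y)`) of `LogSobolevTwoPointGeneral` with THEOREM A.2 = SC 1997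
THEOREM 2.2.8 `Saloffcoste1997_thm_2_2_8` (`α_θ = (1 − 2θ)/log[(1 − θ)/θ]`, `θ ≠ 1/2`) and
`Saloffcoste1997_thm_2_2_8_half'` (`α_{1/2} = 1/2`); the kernel `K(x,y) = π(y)` is `limitMatrix π`
(`PeskunOrdering`) with THEOREM A.1 = SC 1997 THEOREM 2.2.9 `Saloffcoste1997_thm_2_2_9`
(`LogSobolevPiChain`) and `spectralGapR_limitMatrix` (`λ = 1`, `SpectralProfileCompleteGraph`); the
homogeneities `logSobolevConst_smul_kernel` (`LogSobolevProductChains`) and `spectralGapR_smul_kernel`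
(`MultiproposalPeskunBound`); the simple random walk on `ℤ_n` is `cycleWalk n` (`CycleEigenfunctions`,
uniform law written `fun _ => 1/n` there).  A positive probability vector on `Fin 2` IS `twoPointPiGen θ`
with `θ = π(1)` (`eq_twoPointPiGen`), so Corollary A.3 is typed for an arbitrary positive `π` on
`Fin 2` and an arbitrary row-stochastic `K` having `π` stationary.

## Content
* §1 `logSobolevConst_of_dirichletForm_eq_mul`, `spectralGapR_of_dirichletForm_eq_mul`: proportional
  Dirichlet forms `𝓔_K = c𝓔_{K'}` (`c ≥ 0`, same `π`) give `α(K) = cα(K')`, `λ(K) = cλ(K')` — the one-line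
  mechanism of both corollaries ("The Dirichlet form `𝓔_K` equals …, whereas the Dirichlet form used in
  Theorem A.2 is …").
* §2 (two states) `eq_twoPointPiGen`; `twoState_balance` (stationarity on two points is reversibility,
  `π(0)K(0,1) = π(1)K(1,0)`); `dirichletForm_twoState` (`𝓔_K(f,f) = K(0,1)π(0)|f(0) − f(1)|²`);
  **`DiaconisSaloffcoste1996_cor_A_3`** (`π(0) ≠ π(1)`: `α(K) = K(0,1)(1 − 2π(0))/(π(1)log[π(1)/π(0)])` —
  the printed "assume `π(0) ≤ π(1)` … otherwise reverse the roles" is automatic: by `π(0)K(0,1) =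
  π(1)K(1,0)` the displayed expression is invariant under `0 ↔ 1`, so no order hypothesis is needed);
  **`DiaconisSaloffcoste1996_cor_A_3_half`** (`π(0) = π(1)`: `α(K) = K(0,1)`, the formula read at its
  limit value as in Thm A.2); the REMARK: `spectralGapR_twoPointKernelGen` (`λ(K_θ) = 1`),
  **`DiaconisSaloffcoste1996_twoState_spectralGapR`** (`λ = K(0,1) + K(1,0)`),
  `DiaconisSaloffcoste1996_twoState_ratio` (`α = [(1 − 2π(0))/log(π(1)/π(0))]·λ`), `twoPointConst_lt_half`
  (STRICT `(1 − 2θ)/log[(1 − θ)/θ] < 1/2` for `θ ≠ 1/2`, sharpening `twoPointConst_le_half` of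
  `LogSobolevPiChain`), `DiaconisSaloffcoste1996_twoState_lt_half` (`α < λ/2` when `π(0) ≠ 1/2` and
  `K(0,1) ≠ 0`) and `DiaconisSaloffcoste1996_twoState_eq_half` (`α = λ/2` when `π(0) = 1/2`).
* §3 (complete graph) `completeGraphKernel X` (`K(x,y) = 1/(|X| − 1)` off the diagonal, `0` on it) with
  `_apply`, `_isRowStochastic`, `_symm`, `_detailedBalance`, `_isStationary` (uniform `π ≡ 1/|X|`),
  `dirichletForm_completeGraphKernel` (`𝓔_K = |X|/(|X| − 1) · Var_π`), `spectralGapR_completeGraphKernel`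
  (`λ = |X|/(|X| − 1)`), **`DiaconisSaloffcoste1996_cor_A_5`** (`|X| ≥ 3`:
  `α = (|X| − 2)/((|X| − 1)log(|X| − 1))`); `cycleWalk_three_apply`, `cycleWalk_three_eq_completeGraphKernel`
  (SRW on `ℤ₃` IS the loop-free walk on `K₃`), **`DiaconisSaloffcoste1996_cor_A_5_Z3`** (`α = 1/(2 log 2)`),
  `spectralGapR_cycleWalk_three` (`λ = 3/2`), `DiaconisSaloffcoste1996_cor_A_5_Z3_lt` (`α < λ/2 = 3/4`,
  from Mathlib's `Real.log_two_gt_d9`).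

NOT HERE: `|X| = 2` in Cor A.5 (the deterministic swap on two points: `π_* = 1/2`, where the printed
expression is `0/0`; that chain is Cor A.3's equal-mass case with `K(0,1) = 1`, `α = 1`).
-/

namespace Literature.Probability.MarkovChains

open Finset Matrix Set

/-! ## §1 Proportional Dirichlet forms have proportional constants -/

section Scaling

variable {X : Type*} [Fintype X] [DecidableEq X]

omit [DecidableEq X] in
/-- If `𝓔_K(f,f) = c·𝓔_{K'}(f,f)` for all `f` (`c ≥ 0`, same `π`), then `α(K) = c·α(K')` — the step
"The Dirichlet form `𝓔_K` equals `K(0,1)π(0)|f(0) − f(1)|²`, whereas the Dirichlet form used in Theorem A.2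
is `π(0)π(1)|f(0) − f(1)|²`. This proves the corollary." [cite: DiaconisSaloffcoste1996, App. Cor A.3
(proof)] -/
theorem logSobolevConst_of_dirichletForm_eq_mul {π : X → ℝ} {K K' : Matrix X X ℝ} {c : ℝ}
    (hc : 0 ≤ c) (h : ∀ f, dirichletForm π K f = c * dirichletForm π K' f) :
    logSobolevConst π K = c * logSobolevConst π K' := by
  rw [← logSobolevConst_smul_kernel π K' hc]
  unfold logSobolevConst
  have e : (fun f => dirichletForm π K f / entForm π f)
      = fun f => dirichletForm π (c • K') f / entForm π f := by
    funext f
    rw [h, dirichletForm_smul_kernel']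
  rw [e]

omit [DecidableEq X] in
/-- If `𝓔_K(f,f) = c·𝓔_{K'}(f,f)` for all `f` (`c ≥ 0`, same `π`), then `λ(K) = c·λ(K')` (used for
"Observe that `K` has spectral gap `λ = K(0,1) + K(1,0)`"). [cite: DiaconisSaloffcoste1996, App.,
Remark after Cor A.3] -/
theorem spectralGapR_of_dirichletForm_eq_mul {π : X → ℝ} {K K' : Matrix X X ℝ} {c : ℝ}
    (hc : 0 ≤ c) (h : ∀ f, dirichletForm π K f = c * dirichletForm π K' f) :
    spectralGapR π K = c * spectralGapR π K' := by
  rw [← spectralGapR_smul_kernel π K' hc]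
  unfold spectralGapR
  have e : (fun f => dirichletForm π K f) = fun f => dirichletForm π (c • K') f := by
    funext f
    rw [h, dirichletForm_smul_kernel]
  rw [e]

end Scaling

/-! ## §2 Two-state chains (Corollary A.3 and the Remark) -/

section TwoState

/-- A probability vector on `{0,1}` is `π_θ = (1 − θ, θ)` with `θ = π(1)`. [cite:
DiaconisSaloffcoste1996, App. Cor A.3 (a kernel "with stationary distribution `π(x)`" on `X = {0,1}`)] -/
theorem eq_twoPointPiGen {π : Fin 2 → ℝ} (hπ1 : ∑ x, π x = 1) : π = twoPointPiGen (π 1) := by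
  have h : π 0 + π 1 = 1 := by simpa [Fin.sum_univ_two] using hπ1
  funext x
  fin_cases x
  · show π 0 = twoPointPiGen (π 1) 0
    rw [twoPointPiGen_zero]
    linarith
  · rfl

/-- On two points stationarity is reversibility: `π(0)K(0,1) = π(1)K(1,0)` for a row-stochastic `K`
with `π` stationary. [cite: DiaconisSaloffcoste1996, App. Cor A.3 (proof: "The Dirichlet form `𝓔_K`
equals `K(0,1)π(0)|f(0) − f(1)|²`")] -/
theorem twoState_balance {π : Fin 2 → ℝ} {K : Matrix (Fin 2) (Fin 2) ℝ} (hK : IsRowStochastic K)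
    (hst : IsStationary π K) : π 0 * K 0 1 = π 1 * K 1 0 := by
  have h0 : π 0 * K 0 0 + π 1 * K 1 0 = π 0 := by simpa [Fin.sum_univ_two] using hst 0
  have r0 : K 0 0 + K 0 1 = 1 := by simpa [Fin.sum_univ_two] using hK.2 0
  linear_combination π 0 * r0 - h0

/-- "The Dirichlet form `𝓔_K` equals `K(0,1)π(0)|f(0) − f(1)|²`." [cite: DiaconisSaloffcoste1996,
App. Cor A.3 (proof)] -/
theorem dirichletForm_twoState {π : Fin 2 → ℝ} {K : Matrix (Fin 2) (Fin 2) ℝ} (hK : IsRowStochastic K)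
    (hst : IsStationary π K) (f : Fin 2 → ℝ) :
    dirichletForm π K f = K 0 1 * π 0 * (f 0 - f 1) ^ 2 := by
  have hb := twoState_balance hK hst
  unfold dirichletForm
  simp only [Fin.sum_univ_two]
  linear_combination (-(1 / 2 : ℝ) * (f 0 - f 1) ^ 2) * hb

/-- **COROLLARY A.3** (Diaconis–Saloff-Coste 1996).  "Let `X = {0,1}`. Let `K` be a Markov kernel on `X`
with stationary distribution `π(x)` … Then the log-Sobolev constant `α = α(K)` equals
`K(0,1)(1 − 2π(0))/(π(1) log[π(1)/π(0)])`."  Typed for any positive probability vector `π` on `Fin 2`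
with `π(0) ≠ π(1)` and any row-stochastic `K` with `π` stationary (the printed "Assume `π(0) ≤ π(1)` …
If `π(1) ≤ π(0)`, reverse the roles of `0` and `1`" needs no hypothesis: the expression is invariant under
the swap because `π(0)K(0,1) = π(1)K(1,0)`; the equal-mass case is `DiaconisSaloffcoste1996_cor_A_3_half`).
Proof as printed: `𝓔_K = [K(0,1)/π(1)]·𝓔_θ` with `θ = π(1)`, and Theorem A.2
(`Saloffcoste1997_thm_2_2_8`). [cite: DiaconisSaloffcoste1996, App. Cor A.3] -/
theorem DiaconisSaloffcoste1996_cor_A_3 {π : Fin 2 → ℝ} (hπ : ∀ x, 0 < π x) (hπ1 : ∑ x, π x = 1)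
    (hne : π 0 ≠ π 1) {K : Matrix (Fin 2) (Fin 2) ℝ} (hK : IsRowStochastic K)
    (hst : IsStationary π K) :
    logSobolevConst π K = K 0 1 * (1 - 2 * π 0) / (π 1 * Real.log (π 1 / π 0)) := by
  have hsc := dirichletForm_twoState hK hst
  have h01 : 0 ≤ K 0 1 := hK.1 0 1
  have hsum : π 0 + π 1 = 1 := by simpa [Fin.sum_univ_two] using hπ1
  have hhalf : π 1 ≠ 1 / 2 := fun h => hne (by linarith)
  have hp0 : 0 < π 0 := hπ 0
  have hp1 : 0 < π 1 := hπ 1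
  obtain ⟨θ, rfl⟩ : ∃ θ, π = twoPointPiGen θ := ⟨π 1, eq_twoPointPiGen hπ1⟩
  simp only [twoPointPiGen_zero, twoPointPiGen_one] at hsc hhalf hp0 hp1 ⊢
  have hθ1 : θ < 1 := by linarith
  have hc : 0 ≤ K 0 1 / θ := div_nonneg h01 hp1.le
  have hscale : ∀ f, dirichletForm (twoPointPiGen θ) K f
      = K 0 1 / θ * dirichletForm (twoPointPiGen θ) (twoPointKernelGen θ) f := by
    intro f
    rw [hsc, dirichletForm_twoPointGen]
    field_simp
  rw [logSobolevConst_of_dirichletForm_eq_mul hc hscale, Saloffcoste1997_thm_2_2_8 hp1 hθ1 hhalf]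
  have hL : Real.log (θ / (1 - θ)) = -Real.log ((1 - θ) / θ) := by
    rw [← Real.log_inv, inv_div]
  have hℓ : Real.log ((1 - θ) / θ) ≠ 0 := by
    refine Real.log_ne_zero_of_pos_of_ne_one (div_pos hp0 hp1) ?_
    intro h
    rw [div_eq_one_iff_eq hp1.ne'] at h
    exact hhalf (by linarith)
  rw [hL]
  field_simp
  ring

/-- Corollary A.3 in the equal-mass case `π(0) = π(1) = 1/2` (the printed formula read at its limit
value, as in Theorem A.2: "At `θ = 1/2`, `(1 − 2θ)/log[(1 − θ)/θ]` must be replaced by its limit value,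
which is equal to `1/2`"): `α(K) = 2K(0,1)·α_{1/2} = K(0,1)`. [cite: DiaconisSaloffcoste1996, App.
Cor A.3 with Thm A.2] -/
theorem DiaconisSaloffcoste1996_cor_A_3_half {π : Fin 2 → ℝ} (hπ1 : ∑ x, π x = 1) (heq : π 0 = π 1)
    {K : Matrix (Fin 2) (Fin 2) ℝ} (hK : IsRowStochastic K) (hst : IsStationary π K) :
    logSobolevConst π K = K 0 1 := by
  have hsc := dirichletForm_twoState hK hst
  have h01 : 0 ≤ K 0 1 := hK.1 0 1
  have hsum : π 0 + π 1 = 1 := by simpa [Fin.sum_univ_two] using hπ1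
  have h1 : π 1 = 1 / 2 := by linarith
  obtain ⟨θ, rfl⟩ : ∃ θ, π = twoPointPiGen θ := ⟨π 1, eq_twoPointPiGen hπ1⟩
  simp only [twoPointPiGen_zero, twoPointPiGen_one] at hsc h1
  subst h1
  have hscale : ∀ f, dirichletForm (twoPointPiGen (1 / 2)) K f
      = 2 * K 0 1 * dirichletForm (twoPointPiGen (1 / 2)) (twoPointKernelGen (1 / 2)) f := by
    intro f
    rw [hsc, dirichletForm_twoPointGen]
    ring
  rw [logSobolevConst_of_dirichletForm_eq_mul (by positivity) hscale, Saloffcoste1997_thm_2_2_8_half']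
  ring

/-- `λ(K_θ) = 1` for the two-point chain `K_θ(x,y) = π_θ(y)` (`0 < θ < 1`): it is `limitMatrix π_θ`.
[cite: DiaconisSaloffcoste1996, App., Remark after Cor A.3 (`λ = K(0,1) + K(1,0)`, here `θ + (1 − θ)`)] -/
theorem spectralGapR_twoPointKernelGen {θ : ℝ} (hθ0 : 0 < θ) (hθ1 : θ < 1) :
    spectralGapR (twoPointPiGen θ) (twoPointKernelGen θ) = 1 := by
  have e : twoPointKernelGen θ = limitMatrix (twoPointPiGen θ) := by
    ext x y
    rw [twoPointKernelGen_apply, limitMatrix_apply]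
  rw [e]
  exact spectralGapR_limitMatrix (twoPointPiGen_pos hθ0 hθ1) (twoPointPiGen_sum θ)

/-- **REMARK** (after Cor A.3): "Observe that `K` has spectral gap `λ = K(0,1) + K(1,0)`" — for any
positive probability vector `π` on two points and any row-stochastic `K` with `π` stationary (`λ` the
variational spectral gap `spectralGapR`). [cite: DiaconisSaloffcoste1996, App., Remark after Cor A.3] -/
theorem DiaconisSaloffcoste1996_twoState_spectralGapR {π : Fin 2 → ℝ} (hπ : ∀ x, 0 < π x)
    (hπ1 : ∑ x, π x = 1) {K : Matrix (Fin 2) (Fin 2) ℝ} (hK : IsRowStochastic K)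
    (hst : IsStationary π K) : spectralGapR π K = K 0 1 + K 1 0 := by
  have hsc := dirichletForm_twoState hK hst
  have hb := twoState_balance hK hst
  have h01 : 0 ≤ K 0 1 := hK.1 0 1
  have hp0 : 0 < π 0 := hπ 0
  have hp1 : 0 < π 1 := hπ 1
  obtain ⟨θ, rfl⟩ : ∃ θ, π = twoPointPiGen θ := ⟨π 1, eq_twoPointPiGen hπ1⟩
  simp only [twoPointPiGen_zero, twoPointPiGen_one] at hsc hb hp0 hp1
  have hθ1 : θ < 1 := by linarith
  have hc : 0 ≤ K 0 1 / θ := div_nonneg h01 hp1.le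
  have hscale : ∀ f, dirichletForm (twoPointPiGen θ) K f
      = K 0 1 / θ * dirichletForm (twoPointPiGen θ) (twoPointKernelGen θ) f := by
    intro f
    rw [hsc, dirichletForm_twoPointGen]
    field_simp
  rw [spectralGapR_of_dirichletForm_eq_mul hc hscale, spectralGapR_twoPointKernelGen hp1 hθ1, mul_one,
    div_eq_iff hp1.ne']
  linear_combination hb

/-- "It follows that the ratio `α_K/λ_K = (1 − 2π(0))/log[π(1)/π(0)]`": `α = c(π)·λ` with
`c(π) = (1 − 2π(0))/log[π(1)/π(0)]` (`π(0) ≠ π(1)`; written multiplicatively, so the degenerate kernel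
`K(0,1) = 0`, where `α = λ = 0`, is included). [cite: DiaconisSaloffcoste1996, App., Remark after
Cor A.3] -/
theorem DiaconisSaloffcoste1996_twoState_ratio {π : Fin 2 → ℝ} (hπ : ∀ x, 0 < π x)
    (hπ1 : ∑ x, π x = 1) (hne : π 0 ≠ π 1) {K : Matrix (Fin 2) (Fin 2) ℝ} (hK : IsRowStochastic K)
    (hst : IsStationary π K) :
    logSobolevConst π K = (1 - 2 * π 0) / Real.log (π 1 / π 0) * spectralGapR π K := by
  rw [DiaconisSaloffcoste1996_cor_A_3 hπ hπ1 hne hK hst,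
    DiaconisSaloffcoste1996_twoState_spectralGapR hπ hπ1 hK hst]
  have hb := twoState_balance hK hst
  have hsum : π 0 + π 1 = 1 := by simpa [Fin.sum_univ_two] using hπ1
  have h1 : π 1 ≠ 0 := (hπ 1).ne'
  have e : K 0 1 + K 1 0 = K 0 1 / π 1 := by
    rw [eq_div_iff h1]
    linear_combination (-1 : ℝ) * hb + K 0 1 * hsum
  rw [e]
  ring

/-- `2(t − 1)/(t + 1) < log t` for `t > 1` (STRICT logarithmic-mean < arithmetic-mean inequality:
`h(t) = log t − 2(t − 1)/(t + 1)` has `h(1) = 0` and `h'(t) = (t − 1)²/(t(t + 1)²) > 0` on `(1, ∞)`).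
[folklore] -/
private theorem two_mul_sub_div_lt_log {t : ℝ} (ht : 1 < t) :
    2 * (t - 1) / (t + 1) < Real.log t := by
  set h : ℝ → ℝ := fun s => Real.log s - 2 * (s - 1) / (s + 1) with hh
  have hd : ∀ s : ℝ, 0 < s → HasDerivAt h ((s - 1) ^ 2 / (s * (s + 1) ^ 2)) s := by
    intro s hs
    have hs1 : s + 1 ≠ 0 := by linarith
    have h1 : HasDerivAt (fun s => Real.log s) s⁻¹ s := Real.hasDerivAt_log hs.ne'
    have h2 : HasDerivAt (fun s : ℝ => 2 * (s - 1)) (2 * 1) s :=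
      ((hasDerivAt_id s).sub_const 1).const_mul 2
    have h3 : HasDerivAt (fun s : ℝ => s + 1) 1 s := (hasDerivAt_id s).add_const 1
    have h4 := h2.div h3 hs1
    have h := h1.sub h4
    refine h.congr_deriv ?_
    field_simp
    ring
  have hmono : StrictMonoOn h (Ici 1) := by
    refine strictMonoOn_of_deriv_pos (convex_Ici 1) ?_ ?_
    · exact fun s hs => (hd s (lt_of_lt_of_le one_pos hs)).continuousAt.continuousWithinAt
    · rw [interior_Ici]
      intro s hs
      have hs0 : 0 < s := lt_trans one_pos hs
      have hs1 : 0 < s - 1 := by linarith [mem_Ioi.1 hs]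
      rw [(hd s hs0).deriv]
      exact div_pos (pow_pos hs1 2) (by positivity)
  have h1 : h 1 = 0 := by simp [hh]
  have := hmono (mem_Ici.2 le_rfl) (mem_Ici.2 ht.le) ht
  rw [h1] at this
  simp only [hh] at this
  linarith

/-- **`c(θ) < 1/2` strictly off `θ = 1/2`**: `(1 − 2θ)/log[(1 − θ)/θ] < 1/2` for `0 < θ < 1`, `θ ≠ 1/2`
("`≤ 1/2` with strict inequality unless `π(0) = 1/2`"; sharpens `twoPointConst_le_half`).
[cite: DiaconisSaloffcoste1996, App., Remark after Cor A.3] -/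
theorem twoPointConst_lt_half {θ : ℝ} (hθ0 : 0 < θ) (hθ1 : θ < 1) (hθ : θ ≠ 1 / 2) :
    (1 - 2 * θ) / Real.log ((1 - θ) / θ) < 1 / 2 := by
  -- reduce to θ < 1/2 by symmetry
  wlog hlt : θ < 1 / 2 generalizing θ
  · have hgt : 1 / 2 < θ := lt_of_le_of_ne (not_lt.1 hlt) (Ne.symm hθ)
    have h := this (θ := 1 - θ) (by linarith) (by linarith) (fun h => hθ (by linarith)) (by linarith)
    rwa [twoPointConst_symm hθ0 hθ1] at h
  have hp : 0 < 1 - θ := by linarith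
  set t := (1 - θ) / θ with ht
  have ht1 : 1 < t := by rw [ht, lt_div_iff₀ hθ0]; linarith
  have hlog : 0 < Real.log t := Real.log_pos ht1
  have key := two_mul_sub_div_lt_log ht1
  -- `2(t − 1)/(t + 1) = 2(1 − 2θ)`
  have e : 2 * (t - 1) / (t + 1) = 2 * (1 - 2 * θ) := by
    rw [ht]; field_simp; ring
  rw [e] at key
  rw [div_lt_iff₀ hlog]
  linarith

/-- **REMARK, strict case**: for a two-state chain with `π(0) ≠ 1/2` (i.e. `π(0) ≠ π(1)`) and
`K(0,1) ≠ 0`, `α(K) < λ(K)/2` — "the ratio `α_K/λ_K … ≤ 1/2` with strict inequality unless `π(0) = 1/2`.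
Thus, for all chains on a two-point space having `π(0) ≠ 1/2`, `α < λ/2`" (for the degenerate `K(0,1) = 0`
both sides vanish). [cite: DiaconisSaloffcoste1996, App., Remark after Cor A.3] -/
theorem DiaconisSaloffcoste1996_twoState_lt_half {π : Fin 2 → ℝ} (hπ : ∀ x, 0 < π x)
    (hπ1 : ∑ x, π x = 1) (hne : π 0 ≠ π 1) {K : Matrix (Fin 2) (Fin 2) ℝ} (hK : IsRowStochastic K)
    (hst : IsStationary π K) (h01 : K 0 1 ≠ 0) :
    logSobolevConst π K < spectralGapR π K / 2 := by
  rw [DiaconisSaloffcoste1996_twoState_ratio hπ hπ1 hne hK hst]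
  have hsum : π 0 + π 1 = 1 := by simpa [Fin.sum_univ_two] using hπ1
  have hgap : 0 < spectralGapR π K := by
    rw [DiaconisSaloffcoste1996_twoState_spectralGapR hπ hπ1 hK hst]
    have := hK.1 1 0
    have h01' : 0 < K 0 1 := lt_of_le_of_ne (hK.1 0 1) (Ne.symm h01)
    linarith
  have hc : (1 - 2 * π 0) / Real.log (π 1 / π 0) < 1 / 2 := by
    have e : π 1 = 1 - π 0 := by linarith
    rw [e]
    exact twoPointConst_lt_half (hπ 0) (by linarith [hπ 1]) (fun h => hne (by linarith))
  nlinarith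

/-- **REMARK, equality case**: when `π(0) = π(1) = 1/2`, `α(K) = K(0,1) = λ(K)/2` ("with strict
inequality unless `π(0) = 1/2`"). [cite: DiaconisSaloffcoste1996, App., Remark after Cor A.3] -/
theorem DiaconisSaloffcoste1996_twoState_eq_half {π : Fin 2 → ℝ} (hπ : ∀ x, 0 < π x)
    (hπ1 : ∑ x, π x = 1) (heq : π 0 = π 1) {K : Matrix (Fin 2) (Fin 2) ℝ} (hK : IsRowStochastic K)
    (hst : IsStationary π K) :
    logSobolevConst π K = spectralGapR π K / 2 := by
  rw [DiaconisSaloffcoste1996_cor_A_3_half hπ1 heq hK hst,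
    DiaconisSaloffcoste1996_twoState_spectralGapR hπ hπ1 hK hst]
  have hb := twoState_balance hK hst
  rw [heq] at hb
  have h10 : K 1 0 = K 0 1 := (mul_left_cancel₀ (hπ 1).ne' hb).symm
  rw [h10]
  ring

end TwoState

/-! ## §3 The loop-free walk on the complete graph (Corollary A.5) -/

section CompleteGraph

variable (X : Type*) [Fintype X] [DecidableEq X]

/-- The kernel of Corollary A.5: "`K(x,y) = 1/(|X| − 1)` if `x ≠ y` and `K(x,x) = 0`" (the simple random
walk on the complete graph without loops). [cite: DiaconisSaloffcoste1996, App. Cor A.5] -/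
noncomputable def completeGraphKernel : Matrix X X ℝ :=
  Matrix.of fun x y => if x = y then 0 else ((Fintype.card X : ℝ) - 1)⁻¹

variable {X}

/-- Entries of `completeGraphKernel`. [cite: DiaconisSaloffcoste1996, App. Cor A.5] -/
@[simp] theorem completeGraphKernel_apply (x y : X) :
    completeGraphKernel X x y = if x = y then 0 else ((Fintype.card X : ℝ) - 1)⁻¹ := rfl

/-- `completeGraphKernel` is symmetric. [cite: DiaconisSaloffcoste1996, App. Cor A.5] -/
theorem completeGraphKernel_symm (x y : X) : completeGraphKernel X x y = completeGraphKernel X y x := by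
  simp only [completeGraphKernel_apply, eq_comm]

/-- The row sums: `Σ_y K(x,y) = (|X| − 1)·(|X| − 1)⁻¹ = 1` for `|X| ≥ 2`. [cite: DiaconisSaloffcoste1996,
App. Cor A.5 ("the Markov kernel")] -/
theorem completeGraphKernel_isRowStochastic [Nontrivial X] : IsRowStochastic (completeGraphKernel X) := by
  have hn : (1 : ℝ) < Fintype.card X := by exact_mod_cast Fintype.one_lt_card
  have hc : (0 : ℝ) ≤ ((Fintype.card X : ℝ) - 1)⁻¹ := inv_nonneg.2 (by linarith)
  refine ⟨fun x y => ?_, fun x => ?_⟩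
  · rw [completeGraphKernel_apply]
    split_ifs
    · exact le_rfl
    · exact hc
  · have e : ∀ y, completeGraphKernel X x y
        = ((Fintype.card X : ℝ) - 1)⁻¹ - if x = y then ((Fintype.card X : ℝ) - 1)⁻¹ else 0 := by
      intro y
      rw [completeGraphKernel_apply]
      split_ifs <;> ring
    simp_rw [e, Finset.sum_sub_distrib, Finset.sum_ite_eq, Finset.mem_univ, if_true, Finset.sum_const,
      Finset.card_univ, nsmul_eq_mul]
    have : (Fintype.card X : ℝ) - 1 ≠ 0 := by linarith
    rw [← sub_one_mul]
    exact mul_inv_cancel₀ this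

/-- "This has stationary measure `π ≡ 1/|X|`": the uniform law is reversible for `completeGraphKernel`
(symmetry). [cite: DiaconisSaloffcoste1996, App. Cor A.5] -/
theorem completeGraphKernel_detailedBalance :
    DetailedBalance (fun _ : X => (Fintype.card X : ℝ)⁻¹) (completeGraphKernel X) := fun x y => by
  rw [completeGraphKernel_symm x y]

/-- "This has stationary measure `π ≡ 1/|X|`" (`|X| ≥ 2`). [cite: DiaconisSaloffcoste1996, App. Cor A.5] -/
theorem completeGraphKernel_isStationary [Nontrivial X] :
    IsStationary (fun _ : X => (Fintype.card X : ℝ)⁻¹) (completeGraphKernel X) := by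
  intro y
  have hrow := (completeGraphKernel_isRowStochastic (X := X)).2 y
  simp_rw [completeGraphKernel_symm _ y, ← Finset.mul_sum, hrow, mul_one]

/-- The Dirichlet form of the loop-free walk is a multiple of the variance: `𝓔_K(f,f) =
[|X|/(|X| − 1)]·𝓔_{π}(f,f)` where `𝓔_π = Var_π` is the form of the chain `K(x,y) = π(y) = 1/|X|` of
Theorem A.1 ("This readily follows from Theorem A.1"; `|X| ≥ 2`). [cite: DiaconisSaloffcoste1996,
App. Cor A.5 (proof)] -/
theorem dirichletForm_completeGraphKernel [Nontrivial X] (f : X → ℝ) :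
    dirichletForm (fun _ : X => (Fintype.card X : ℝ)⁻¹) (completeGraphKernel X) f
      = Fintype.card X / ((Fintype.card X : ℝ) - 1)
        * dirichletForm (fun _ : X => (Fintype.card X : ℝ)⁻¹)
            (limitMatrix (fun _ : X => (Fintype.card X : ℝ)⁻¹)) f := by
  have hn : (1 : ℝ) < Fintype.card X := by exact_mod_cast Fintype.one_lt_card
  have hn1 : (Fintype.card X : ℝ) - 1 ≠ 0 := by linarith
  have hn0 : (Fintype.card X : ℝ) ≠ 0 := by linarith
  unfold dirichletForm
  have e : ∀ x y : X, (Fintype.card X : ℝ)⁻¹ * completeGraphKernel X x y * (f x - f y) ^ 2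
      = Fintype.card X / ((Fintype.card X : ℝ) - 1)
        * ((Fintype.card X : ℝ)⁻¹ * limitMatrix (fun _ : X => (Fintype.card X : ℝ)⁻¹) x y
            * (f x - f y) ^ 2) := by
    intro x y
    rw [completeGraphKernel_apply, limitMatrix_apply]
    split_ifs with h
    · subst h; simp
    · field_simp
  simp_rw [e, ← Finset.mul_sum]
  ring

/-- `λ = |X|/(|X| − 1)` for the loop-free walk on the complete graph (`|X| ≥ 2`; `= 3/2` on `ℤ₃`:
"Observe that simple random walk on `ℤ₃` has spectral gap `λ = 1 − cos(2π/3) = 3/2`").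
[cite: DiaconisSaloffcoste1996, App. Cor A.5] -/
theorem spectralGapR_completeGraphKernel [Nontrivial X] :
    spectralGapR (fun _ : X => (Fintype.card X : ℝ)⁻¹) (completeGraphKernel X)
      = Fintype.card X / ((Fintype.card X : ℝ) - 1) := by
  have hn : (1 : ℝ) < Fintype.card X := by exact_mod_cast Fintype.one_lt_card
  have hπ : ∀ x : X, 0 < (fun _ : X => (Fintype.card X : ℝ)⁻¹) x := fun _ => inv_pos.2 (by linarith)
  have hπ1 : ∑ x : X, (fun _ : X => (Fintype.card X : ℝ)⁻¹) x = 1 := by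
    rw [Finset.sum_const, Finset.card_univ, nsmul_eq_mul]
    exact mul_inv_cancel₀ (by linarith)
  have hc : (0 : ℝ) ≤ Fintype.card X / ((Fintype.card X : ℝ) - 1) := by
    have : (0 : ℝ) < (Fintype.card X : ℝ) - 1 := by linarith
    positivity
  rw [spectralGapR_of_dirichletForm_eq_mul hc (dirichletForm_completeGraphKernel (X := X)),
    spectralGapR_limitMatrix hπ hπ1, mul_one]

/-- **COROLLARY A.5** (Diaconis–Saloff-Coste 1996).  "On a finite set `X`, consider the Markov kernel
`K(x,y) = 1/(|X| − 1)` if `x ≠ y` and `K(x,x) = 0`. This has stationary measure `π ≡ 1/|X|`. The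
associated logarithmic Sobolev constant is `α = (|X| − 2)/((|X| − 1) log(|X| − 1))`."  Typed for
`|X| ≥ 3` (for `|X| = 2` the printed expression is `0/0`; see the module docstring).  Proof as printed:
"This readily follows from Theorem A.1" — `𝓔_K = [|X|/(|X| − 1)]Var_π` and `Saloffcoste1997_thm_2_2_9`
with `π_* = 1/|X| < 1/2`. [cite: DiaconisSaloffcoste1996, App. Cor A.5] -/
theorem DiaconisSaloffcoste1996_cor_A_5 (hX : 3 ≤ Fintype.card X) :
    logSobolevConst (fun _ : X => (Fintype.card X : ℝ)⁻¹) (completeGraphKernel X)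
      = ((Fintype.card X : ℝ) - 2) / (((Fintype.card X : ℝ) - 1) * Real.log ((Fintype.card X : ℝ) - 1)) := by
  haveI : Nontrivial X := Fintype.one_lt_card_iff_nontrivial.1 (by omega)
  obtain ⟨x₀⟩ : Nonempty X := inferInstance
  have hn3 : (3 : ℝ) ≤ Fintype.card X := by exact_mod_cast hX
  have hn0 : (Fintype.card X : ℝ) ≠ 0 := by linarith
  have hπ : ∀ x : X, 0 < (fun _ : X => (Fintype.card X : ℝ)⁻¹) x := fun _ => inv_pos.2 (by linarith)
  have hπ1 : ∑ x : X, (fun _ : X => (Fintype.card X : ℝ)⁻¹) x = 1 := by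
    rw [Finset.sum_const, Finset.card_univ, nsmul_eq_mul]
    exact mul_inv_cancel₀ hn0
  have hlt : (fun _ : X => (Fintype.card X : ℝ)⁻¹) x₀ < 1 / 2 := by
    show (Fintype.card X : ℝ)⁻¹ < 1 / 2
    rw [show (1 : ℝ) / 2 = (2 : ℝ)⁻¹ by norm_num, inv_lt_inv₀ (by linarith) (by norm_num)]
    linarith
  have hα := Saloffcoste1997_thm_2_2_9 hπ hπ1 (xm := x₀) (fun _ => le_rfl) hlt
  have hc : (0 : ℝ) ≤ Fintype.card X / ((Fintype.card X : ℝ) - 1) := by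
    have : (0 : ℝ) < (Fintype.card X : ℝ) - 1 := by linarith
    positivity
  rw [logSobolevConst_of_dirichletForm_eq_mul hc (dirichletForm_completeGraphKernel (X := X)), hα]
  have e1 : (1 - (Fintype.card X : ℝ)⁻¹) / (Fintype.card X : ℝ)⁻¹ = (Fintype.card X : ℝ) - 1 := by
    field_simp
  rw [e1]
  have hlog : Real.log ((Fintype.card X : ℝ) - 1) ≠ 0 :=
    Real.log_ne_zero_of_pos_of_ne_one (by linarith) (by linarith)
  have hn1 : (Fintype.card X : ℝ) - 1 ≠ 0 := by linarith
  field_simp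

/-- `ℤ₃` bookkeeping: `l = k ± 1` exactly when `l ≠ k`, and the two moves are distinct. [folklore] -/
private theorem zmod_three_moves :
    ∀ k l : ZMod 3, (k = l → l ≠ k + 1 ∧ l ≠ k - 1) ∧
      (k ≠ l → (l = k + 1 ∧ l ≠ k - 1) ∨ (l ≠ k + 1 ∧ l = k - 1)) := by
  decide

/-- The simple random walk on `ℤ₃` moves to each of the two other points with probability `1/2`.
[cite: DiaconisSaloffcoste1996, App. Cor A.5 ("the simple random walk on `X = ℤ₃`")] -/
theorem cycleWalk_three_apply (k l : ZMod 3) : cycleWalk 3 k l = if k = l then 0 else 1 / 2 := by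
  rw [cycleWalk_apply]
  by_cases hkl : k = l
  · obtain ⟨h1, h2⟩ := (zmod_three_moves k l).1 hkl
    rw [if_neg h1, if_neg h2, if_pos hkl]
    norm_num
  · rcases (zmod_three_moves k l).2 hkl with ⟨h1, h2⟩ | ⟨h1, h2⟩
    · rw [if_pos h1, if_neg h2, if_neg hkl]
      norm_num
    · rw [if_neg h1, if_pos h2, if_neg hkl]
      norm_num

/-- The simple random walk on `ℤ₃` IS the loop-free walk on the complete graph `K₃`.
[cite: DiaconisSaloffcoste1996, App. Cor A.5] -/
theorem cycleWalk_three_eq_completeGraphKernel : cycleWalk 3 = completeGraphKernel (ZMod 3) := by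
  ext k l
  rw [cycleWalk_three_apply, completeGraphKernel_apply, ZMod.card]
  push_cast
  norm_num

/-- **COROLLARY A.5, the case `ℤ₃`**: "the simple random walk on `X = ℤ₃` has log-Sobolev constant
`α = 1/(2 log 2)`" (uniform law written `1/3`, the convention of `CycleEigenfunctions`).
[cite: DiaconisSaloffcoste1996, App. Cor A.5] -/
theorem DiaconisSaloffcoste1996_cor_A_5_Z3 :
    logSobolevConst (fun _ : ZMod 3 => (1 : ℝ) / 3) (cycleWalk 3) = 1 / (2 * Real.log 2) := by
  have e1 : (fun _ : ZMod 3 => (1 : ℝ) / 3) = fun _ : ZMod 3 => (Fintype.card (ZMod 3) : ℝ)⁻¹ := by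
    funext x
    rw [ZMod.card]
    norm_num
  rw [e1, cycleWalk_three_eq_completeGraphKernel,
    DiaconisSaloffcoste1996_cor_A_5 (X := ZMod 3) (by rw [ZMod.card]), ZMod.card]
  push_cast
  norm_num

/-- "Observe that simple random walk on `ℤ₃` has spectral gap `λ = 1 − cos(2π/3) = 3/2`" (the
variational gap `spectralGapR`). [cite: DiaconisSaloffcoste1996, App. Cor A.5] -/
theorem spectralGapR_cycleWalk_three :
    spectralGapR (fun _ : ZMod 3 => (1 : ℝ) / 3) (cycleWalk 3) = 3 / 2 := by
  have e1 : (fun _ : ZMod 3 => (1 : ℝ) / 3) = fun _ : ZMod 3 => (Fintype.card (ZMod 3) : ℝ)⁻¹ := by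
    funext x
    rw [ZMod.card]
    norm_num
  rw [e1, cycleWalk_three_eq_completeGraphKernel, spectralGapR_completeGraphKernel (X := ZMod 3),
    ZMod.card]
  push_cast
  norm_num

/-- "Thus `λ/2 = 0.75` whereas `α ≈ 0.72 < λ/2` in this case": `α(ℤ₃) = 1/(2 log 2) < 3/4 = λ/2`
(`log 2 > 0.6931471803`, Mathlib's `Real.log_two_gt_d9`). [cite: DiaconisSaloffcoste1996, App. Cor A.5] -/
theorem DiaconisSaloffcoste1996_cor_A_5_Z3_lt :
    logSobolevConst (fun _ : ZMod 3 => (1 : ℝ) / 3) (cycleWalk 3)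
      < spectralGapR (fun _ : ZMod 3 => (1 : ℝ) / 3) (cycleWalk 3) / 2 := by
  rw [DiaconisSaloffcoste1996_cor_A_5_Z3, spectralGapR_cycleWalk_three]
  have h2 := Real.log_two_gt_d9
  have hpos : 0 < 2 * Real.log 2 := by linarith
  rw [div_lt_iff₀ hpos]
  nlinarith

end CompleteGraph

end Literature.Probability.MarkovChains
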